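import Literature.MathematicalPhysics.QuantumFieldTheory.BalabanImbrieJaffe1984to88.BIJ88NeumannPropagatorFlatDecay
import Literature.MathematicalPhysics.QuantumFieldTheory.Balaban1983to89.B4Thm19ZeroTorusLevel
import Literature.MathematicalPhysics.QuantumFieldTheory.BalabanImbrieJaffe1984to88.BIJ88DeltaLocFlatClose235

/-!
# `BalabanImbrieJaffe1984to88.BIJ88NeumannPropagatorFlatDecayLevel` — T. Bałaban, J. Imbrie, A. Jaffe, *Effective action and cluster
properties of the abelian Higgs model*, Commun. Math. Phys. **114** (1988) 257–315 [BalabanImbrieJaffe1988], Sect. 2 p. 263 [PDF 7], (2.30)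
*"a straightforward application of the random walk expansion of [6]"*: **[6]'s THEOREM (1.10)/(1.9) FOR THE TORUS PROPAGATOR OF RECORD
`G_k(T_η, 1^h)` AT EVERY PURE-GAUGE BACKGROUND, IN THE PRINT'S LEVEL-`k` UNITS** — the `Ω = T` members of `BIJ88NeumannPropagatorFlatDecay`
(p31 gen 16: `decay110_flat`, `decay110_flat_kernel`, `holder19_flat`, exponent `e^{−δ₀εD}`) RE-STATED with the printed exponent
`e^{−δ₀D/L^k}` (`D/L^k` = the sup-torus distance in the `η = L^{−k}` units of [6] p. 572), the `T_η`-normalisation prefactors `(L^kε)²`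
(value) / `L^kε` (derivative) and the Hölder weight `(L^k/|x₁−x₂|_T)^α`, at EVERY level `1 ≤ k ≤ K` — by swapping the inputs
`B4Thm110ZeroTorus.thm110_zero_torus` / `B4Thm19ZeroTorus.thm19_zero_torus` (the `εD` forms, = print at `k = K` only) for r01 gen 14's
`B4Thm110ZeroTorusLevel.thm110_zero_torus_level` / `B4Thm19ZeroTorusLevel.thm19_zero_torus_level` (same binders).  This serves the last
item of the C2 §§1–4 owner's UNITS NOTE (`HOME/lit-balaban-r18/SECONDREAD-C2.md` § Gen 19 batch 1): with p31 gen 17's §7 of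
`BIJ88DeltaLocFlatClose235` (cube and closeness members) every flat-background member of (2.30)/(2.31)/(2.35)/(2.36) now exists at the
printed, `k`-uniform rate.
v1.1 (append-only): §2 the (2.36)-type kernel decay of [I] (4.6.4)'s `Δ_k(T,1^h) = deltaRegion … univ` on the unit lattice `T^{(k)}` in
level-`k` units, `‖Δ_k(T,1^h;y₁,y₂)‖ ≤ A·([y₁ = y₂] + a_k·c₀·e^{−δ₀|y₁−y₂|_{T^{(k)}}})`, hypothesis-free — p31's `decay236_region_flat_level` (no-wrap
boxes `Ω₀`) with `Ω₀` replaced by the whole torus, from §1's `decay110_flat_level` and p31's sandwich/block-metric lemmas by name.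

statement-level skeleton of published theorems with citation tags; proofs where landed; nothing here is a claim about the Yang–Mills mass gap

PDF held: `paper:balaban1988-cmp114-bij-abelian-higgs-effective-action` (journal page = PDF page + 256); [6] = T. Bałaban, *Regularity and
decay of lattice Green's functions*, Commun. Math. Phys. **89** (1983) 571–597 [Balaban1983RegularityDecay], Theorem p. 573 (1.9)/(1.10),
lattice `ηℤ^d`, `η = L^{−k}` p. 572 (read through r01's level files, which quote it).

CITATION HEADER (lean-in-tree rule).  Part of the lit-balaban TYPED SKELETON (HOME `run/shared/lean/pub/lit-balaban/`), reader/typer seat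
r18 = the C2 §§1–4 fold owner, gen 19 (unit `lit-balaban-r18`; rows C2.Eq2.30 / C2.Claim@263 of `HOME/lit-balaban-r18/ROWS-C2.md`, located
members; heads unchanged = p02's hence-steps).  WHAT IS REPRODUCED: three theorems, proofs = p31's proofs of `decay110_flat` /
`decay110_flat_kernel` / `holder19_flat` VERBATIM with the level-`k` inputs (the real/imaginary-part reduction of the rotated source `h̄f`,
`gBox_pureGauge_mulVec`, `covD_gBox_pureGauge`, `norm_rot` of p31's file by name; its four private `re/im` helpers re-proved privately here).
No definition, no `def … : Prop`, no `sorry`.  HONEST SCOPE: flat backgrounds `u = 1^h` only; `Ω = T` only (cubes: p31's §7); the `εD` forms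
of p31 follow from these by `L^kε ≤ 1`, `εD ≤ D/L^k` (r01's `exp_level_le_eps`) and are not re-derived.
Imports: `BIJ88NeumannPropagatorFlatDecay` (p31), `Balaban1983to89.B4Thm19ZeroTorusLevel` (r01; → `B4Thm110ZeroTorusLevel`); v1.1 adds
`BIJ88DeltaLocFlatClose235` (p31: `deltaRegion_apply`, `norm_qMq_apply_le`, `blockLower_le_T`, `exp_blockLower_level_le`, `scale_identity`).
Literature + Mathlib only.  Unit `lit-balaban-r18` (literature-prover-lit-balaban-r18-g19-0), 2026-08-22.  NOT summit progress.
-/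

namespace Literature.MathematicalPhysics.QuantumFieldTheory.BalabanImbrieJaffe1984to88.BIJ88NeumannPropagatorFlatDecayLevel

open Literature.MathematicalPhysics.QuantumFieldTheory.Balaban1983to89
open BIJ88Sect3Statements (U1 toC cfg covD toC_mul toC_one toC_inv norm_toC)
open BIJ88NeumannPropagator227Torus
open BIJ85BlockAveragesTorus (toC_ne_zero)
open BIJ88DeltaLoc234Torus (mulOp gBox_gaugeAct gBox_gaugeAct_apply)
open BIJ88NeumannPropagatorFlatDecay (gBox_pureGauge_mulVec covD_gBox_pureGauge norm_rot)
open GaugeField (gaugeAct)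
open Matrix Finset

noncomputable section

variable {P : Params}

/-- kernel: the real part of a real matrix applied to a complex vector is the matrix applied to the real part. [folklore] -/
private theorem re_map_mulVec' {m n : Type*} [Fintype n] (G : Matrix m n ℝ) (g : n → ℂ) (x : m) :
    ((G.map Complex.ofRealHom *ᵥ g) x).re = (G *ᵥ fun y => (g y).re) x := by
  simp only [mulVec, dotProduct, map_apply, Complex.ofRealHom_eq_coe, Complex.re_sum, Complex.re_ofReal_mul]

/-- kernel: the same for the imaginary part. [folklore] -/
private theorem im_map_mulVec' {m n : Type*} [Fintype n] (G : Matrix m n ℝ) (g : n → ℂ) (x : m) :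
    ((G.map Complex.ofRealHom *ᵥ g) x).im = (G *ᵥ fun y => (g y).im) x := by
  simp only [mulVec, dotProduct, map_apply, Complex.ofRealHom_eq_coe, Complex.im_sum, Complex.im_ofReal_mul]

/-- kernel: `‖(G g)(x)‖ ≤ |(G Re g)(x)| + |(G Im g)(x)|` for a real matrix `G`. [folklore] -/
private theorem norm_map_mulVec_le' {m n : Type*} [Fintype n] (G : Matrix m n ℝ) (g : n → ℂ) (x : m) :
    ‖(G.map Complex.ofRealHom *ᵥ g) x‖ ≤ |(G *ᵥ fun y => (g y).re) x| + |(G *ᵥ fun y => (g y).im) x| := by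
  rw [← re_map_mulVec', ← im_map_mulVec']
  exact Complex.norm_le_abs_re_add_abs_im _

/-- kernel: `‖z − w‖ ≤ |Re z − Re w| + |Im z − Im w|`. [folklore] -/
private theorem norm_sub_le_re_im' (z w : ℂ) : ‖z - w‖ ≤ |z.re - w.re| + |z.im - w.im| := by
  have h := Complex.norm_le_abs_re_add_abs_im (z - w)
  rwa [Complex.sub_re, Complex.sub_im] at h

/-- **[6] (1.10) FOR THE TORUS PROPAGATOR OF RECORD AT EVERY PURE-GAUGE BACKGROUND, IN LEVEL-`k` UNITS** (*"|(D^η_{A,μ}G_k(Ω, A)f)(x)|,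
|(G_k(Ω, A)f)(x)| ≤ c₀exp(−δ₀ dist(x, supp f))‖f‖_∞ (1.10)"*, [6] p. 573, on the lattice `ηℤ^d`, `η = L^{−k}`, p. 572; C2 (2.30)): there are
`δ₀, c₀ > 0` depending on `(d, L, a)` only such that on EVERY torus of the series with these `d, L`, for every level `1 ≤ k ≤ K`, every gauge
function `h`, every site `x` and every complex source `f` with `‖f‖_∞ ≤ F` supported at sup-torus distance `≥ D` (fine-lattice units; `D/L^k`
in the units of `T_η`) from `x`: the VALUE member `‖(G_k(T,1^h)f)(x)‖ ≤ c₀(L^kε)²e^{−δ₀D/L^k}F` and, for every direction `μ`, the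
COVARIANT-DERIVATIVE member `‖ε⁻¹(u_{⟨x,x+e_μ⟩}(G f)(x+e_μ) − (G f)(x))‖ ≤ c₀(L^kε)e^{−δ₀D/L^k}F`, `u = 1^h`, `G = gBox (α_kL^{kd}) ε⁻¹ u k T`
— p31's `decay110_flat` with r01's `B4Thm110ZeroTorusLevel.thm110_zero_torus_level` as input (the prefactors `(L^kε)²`, `L^kε` are the
`T_η`-normalisation of `G_k`, cf. `BIJ88NeumannPropagatorFlatDecayCube.gBox_cube_eq`). [cite: Balaban1983RegularityDecay, (1.10) p.573]
[cite: BalabanImbrieJaffe1988, (2.30) p.263] -/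
theorem decay110_flat_level (d L : ℕ) (hd : 1 ≤ d) (hL : Odd L ∧ 1 < L) {a : ℝ} (ha : 0 < a) :
    ∃ δ₀ c₀ : ℝ, 0 < δ₀ ∧ 0 < c₀ ∧ ∀ (P : Params), P.d = d → P.L = L →
      ∀ k : ℕ, 1 ≤ k → k ≤ P.K → ∀ (h : GaugeTransf P 0 U1) (x : Balaban1983to89.Site P 0) (f : Balaban1983to89.Site P 0 → ℂ) (F D : ℝ),
        (∀ z, ‖f z‖ ≤ F) → 0 ≤ D → (∀ z, f z ≠ 0 → D ≤ B5Ineq137Torus.T P 0 x z) →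
          ‖(gBox (B1RG242Torus.α P a k * (P.L : ℝ) ^ (k * P.d)) P.eps⁻¹ (gaugeAct h (1 : GaugeField P 0 U1)) k univ *ᵥ f) x‖
              ≤ c₀ * P.spacing k ^ 2 * Real.exp (-(δ₀ * (D / (P.L : ℝ) ^ k))) * F ∧
          ∀ μ : Fin P.d,
            ‖covD P.eps⁻¹ (cfg (gaugeAct h (1 : GaugeField P 0 U1)))
                (gBox (B1RG242Torus.α P a k * (P.L : ℝ) ^ (k * P.d)) P.eps⁻¹ (gaugeAct h (1 : GaugeField P 0 U1)) k univ *ᵥ f) ⟨x, μ⟩‖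
              ≤ c₀ * P.spacing k * Real.exp (-(δ₀ * (D / (P.L : ℝ) ^ k))) * F := by
  obtain ⟨δ₀, c₀, hδ₀, hc₀, H⟩ := B4Thm110ZeroTorusLevel.thm110_zero_torus_level d L hd hL ha (le_refl (0 : ℝ))
  refine ⟨δ₀, 2 * c₀, hδ₀, by positivity, ?_⟩
  intro P hPd hPL k hk1 hkK h x f F D hF hD hsupp
  have hk : k ≤ P.m + P.K := hkK.trans (Nat.le_add_left _ _)
  set g : Balaban1983to89.Site P 0 → ℂ := fun y => (starRingEnd ℂ) (toC (h y)) * f y with hg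
  have hgR : ∀ z, |(g z).re| ≤ F := fun z => ((Complex.abs_re_le_norm _).trans_eq (norm_rot h f z)).trans (hF z)
  have hgI : ∀ z, |(g z).im| ≤ F := fun z => ((Complex.abs_im_le_norm _).trans_eq (norm_rot h f z)).trans (hF z)
  have hsR : ∀ z, (g z).re ≠ 0 → D ≤ B5Ineq137Torus.T P 0 x z := fun z hz =>
    hsupp z fun hf => hz (by simp only [hg, hf, mul_zero, Complex.zero_re])
  have hsI : ∀ z, (g z).im ≠ 0 → D ≤ B5Ineq137Torus.T P 0 x z := fun z hz =>
    hsupp z fun hf => hz (by simp only [hg, hf, mul_zero, Complex.zero_im])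
  obtain ⟨HR, HRd⟩ := H P hPd hPL k hk1 hkK x (fun y => (g y).re) F D hgR hD hsR
  obtain ⟨HI, HId⟩ := H P hPd hPL k hk1 hkK x (fun y => (g y).im) F D hgI hD hsI
  set E : ℝ := c₀ * P.spacing k ^ 2 * Real.exp (-(δ₀ * (D / (P.L : ℝ) ^ k))) * F with hE
  set E' : ℝ := c₀ * P.spacing k * Real.exp (-(δ₀ * (D / (P.L : ℝ) ^ k))) * F with hE'
  have hE2 : 2 * c₀ * P.spacing k ^ 2 * Real.exp (-(δ₀ * (D / (P.L : ℝ) ^ k))) * F = E + E := by rw [hE]; ring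
  have hE2' : 2 * c₀ * P.spacing k * Real.exp (-(δ₀ * (D / (P.L : ℝ) ^ k))) * F = E' + E' := by rw [hE']; ring
  refine ⟨?_, fun μ => ?_⟩
  · rw [gBox_pureGauge_mulVec ha hk1 hk, norm_mul, norm_toC, one_mul, hE2]
    exact (norm_map_mulVec_le' _ g x).trans (add_le_add HR HI)
  · rw [covD_gBox_pureGauge ha hk1 hk, norm_mul, norm_toC, one_mul, hE2']
    have hre : ((((P.eps⁻¹ : ℝ) : ℂ) *
        ((((B1RG242Torus.tower P a 0).G k).map Complex.ofRealHom *ᵥ g) (⟨x, μ⟩ : PBond P 0).tgt -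
          (((B1RG242Torus.tower P a 0).G k).map Complex.ofRealHom *ᵥ g) (⟨x, μ⟩ : PBond P 0).src))).re =
        ((B1RG242Torus.deriv P 0 P.eps μ * (B1RG242Torus.tower P a 0).G k) *ᵥ fun y => (g y).re) x := by
      rw [← mulVec_mulVec, B1RG242Torus.deriv_mulVec, Complex.re_ofReal_mul, Complex.sub_re, re_map_mulVec', re_map_mulVec']
      rfl
    have him : ((((P.eps⁻¹ : ℝ) : ℂ) *
        ((((B1RG242Torus.tower P a 0).G k).map Complex.ofRealHom *ᵥ g) (⟨x, μ⟩ : PBond P 0).tgt -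
          (((B1RG242Torus.tower P a 0).G k).map Complex.ofRealHom *ᵥ g) (⟨x, μ⟩ : PBond P 0).src))).im =
        ((B1RG242Torus.deriv P 0 P.eps μ * (B1RG242Torus.tower P a 0).G k) *ᵥ fun y => (g y).im) x := by
      rw [← mulVec_mulVec, B1RG242Torus.deriv_mulVec, Complex.im_ofReal_mul, Complex.sub_im, im_map_mulVec', im_map_mulVec']
      rfl
    refine (Complex.norm_le_abs_re_add_abs_im _).trans ?_
    rw [hre, him]
    exact add_le_add (HRd μ) (HId μ)

/-- **(1.10) IN LEVEL-`k` UNITS, KERNEL FORM**: `‖G_k(T, 1^h; x, y)‖ ≤ c₀(L^kε)²e^{−δ₀|x−y|_T/L^k}` for all sites `x, y` (the source `δ_y`);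
the printed kernel decay of (2.30)'s input at every level. [cite: Balaban1983RegularityDecay, (1.10) p.573] [cite: BalabanImbrieJaffe1988, (2.30) p.263] -/
theorem decay110_flat_kernel_level (d L : ℕ) (hd : 1 ≤ d) (hL : Odd L ∧ 1 < L) {a : ℝ} (ha : 0 < a) :
    ∃ δ₀ c₀ : ℝ, 0 < δ₀ ∧ 0 < c₀ ∧ ∀ (P : Params), P.d = d → P.L = L →
      ∀ k : ℕ, 1 ≤ k → k ≤ P.K → ∀ (h : GaugeTransf P 0 U1) (x y : Balaban1983to89.Site P 0),
        ‖gBox (B1RG242Torus.α P a k * (P.L : ℝ) ^ (k * P.d)) P.eps⁻¹ (gaugeAct h (1 : GaugeField P 0 U1)) k univ x y‖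
          ≤ c₀ * P.spacing k ^ 2 * Real.exp (-(δ₀ * (B5Ineq137Torus.T P 0 x y / (P.L : ℝ) ^ k))) := by
  obtain ⟨δ₀, c₀, hδ₀, hc₀, H⟩ := decay110_flat_level d L hd hL ha
  refine ⟨δ₀, c₀, hδ₀, hc₀, fun P hPd hPL k hk1 hkK h x y => ?_⟩
  have h1 := (H P hPd hPL k hk1 hkK h x (Pi.single y 1) 1 (B5Ineq137Torus.T P 0 x y)
    (fun z => by by_cases hz : z = y <;> simp [hz]) (B5Ineq137Torus.T_nonneg P 0 x y)
    (fun z hz => by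
      by_cases hzy : z = y
      · rw [hzy]
      · exact absurd (by simp [hzy]) hz)).1
  rwa [mulVec_single_one, col_apply, mul_one] at h1

/-- **[6] (1.9) FOR THE TORUS PROPAGATOR OF RECORD AT EVERY PURE-GAUGE BACKGROUND, IN LEVEL-`k` UNITS** — the Hölder member with the
PRINTED weight and rate: there is `δ₀ > 0` and for every `0 ≤ α < 1` a `c₀ > 0` (from `(d, L, a, α)`) such that, for all data as in
`decay110_flat_level` and all pairs of sites `x₁ ≠ x₂` both at sup-torus distance `≥ D` from `supp f`,
`(L^k/|x₁−x₂|_T)^α·‖u(Γ_{x₁x₂})(D_uG f)(x₂,μ) − (D_uG f)(x₁,μ)‖ ≤ c₀(L^kε)e^{−δ₀D/L^k}F` (`(L^k/|x₁−x₂|_T)^α = |x₁−x₂|_{T_η}^{−α}`,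
[6] p. 572–573), `u(Γ_{x₁x₂}) = h(x₁)h(x₂)^{−1}` written out as in p31's `holder19_flat` — the same proof with r01's
`B4Thm19ZeroTorusLevel.thm19_zero_torus_level` as input. [cite: Balaban1983RegularityDecay, (1.9) p.573] [cite: BalabanImbrieJaffe1988, Claim p.263] -/
theorem holder19_flat_level (d L : ℕ) (hd : 1 ≤ d) (hL : Odd L ∧ 1 < L) {a : ℝ} (ha : 0 < a) :
    ∃ δ₀ : ℝ, 0 < δ₀ ∧ ∀ {α : ℝ}, 0 ≤ α → α < 1 → ∃ c₀ : ℝ, 0 < c₀ ∧ ∀ (P : Params), P.d = d → P.L = L →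
      ∀ k : ℕ, 1 ≤ k → k ≤ P.K → ∀ (h : GaugeTransf P 0 U1) (μ : Fin P.d) (x₁ x₂ : Balaban1983to89.Site P 0), x₂ ≠ x₁ →
        ∀ (f : Balaban1983to89.Site P 0 → ℂ) (F D : ℝ), (∀ z, ‖f z‖ ≤ F) → 0 ≤ D →
          (∀ z, f z ≠ 0 → D ≤ B5Ineq137Torus.T P 0 x₁ z) → (∀ z, f z ≠ 0 → D ≤ B5Ineq137Torus.T P 0 x₂ z) →
            ((P.L : ℝ) ^ k / B5Ineq137Torus.T P 0 x₁ x₂) ^ α *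
              ‖toC (h x₁) * (toC (h x₂))⁻¹ *
                  covD P.eps⁻¹ (cfg (gaugeAct h (1 : GaugeField P 0 U1)))
                    (gBox (B1RG242Torus.α P a k * (P.L : ℝ) ^ (k * P.d)) P.eps⁻¹ (gaugeAct h (1 : GaugeField P 0 U1)) k univ *ᵥ f) ⟨x₂, μ⟩ -
                covD P.eps⁻¹ (cfg (gaugeAct h (1 : GaugeField P 0 U1)))
                    (gBox (B1RG242Torus.α P a k * (P.L : ℝ) ^ (k * P.d)) P.eps⁻¹ (gaugeAct h (1 : GaugeField P 0 U1)) k univ *ᵥ f) ⟨x₁, μ⟩‖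
              ≤ c₀ * P.spacing k * Real.exp (-(δ₀ * (D / (P.L : ℝ) ^ k))) * F := by
  obtain ⟨δ₀, hδ₀, H⟩ := B4Thm19ZeroTorusLevel.thm19_zero_torus_level d L hd hL ha (le_refl (0 : ℝ))
  refine ⟨δ₀, hδ₀, fun {α} hα0 hα1 => ?_⟩
  obtain ⟨c₀, hc₀, Hα⟩ := H hα0 hα1
  refine ⟨2 * c₀, by positivity, ?_⟩
  intro P hPd hPL k hk1 hkK h μ x₁ x₂ hx f F D hF hD hs₁ hs₂
  have hk : k ≤ P.m + P.K := hkK.trans (Nat.le_add_left _ _)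
  set g : Balaban1983to89.Site P 0 → ℂ := fun y => (starRingEnd ℂ) (toC (h y)) * f y with hg
  have hgR : ∀ z, |(g z).re| ≤ F := fun z => ((Complex.abs_re_le_norm _).trans_eq (norm_rot h f z)).trans (hF z)
  have hgI : ∀ z, |(g z).im| ≤ F := fun z => ((Complex.abs_im_le_norm _).trans_eq (norm_rot h f z)).trans (hF z)
  have hne : ∀ z, ((g z).re ≠ 0 ∨ (g z).im ≠ 0) → f z ≠ 0 := fun z hz hf => by
    rcases hz with hz | hz
    · exact hz (by simp only [hg, hf, mul_zero, Complex.zero_re])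
    · exact hz (by simp only [hg, hf, mul_zero, Complex.zero_im])
  obtain HR := Hα P hPd hPL k hk1 hkK μ x₁ x₂ hx (fun y => (g y).re) F D hgR hD (fun z hz => hs₁ z (hne z (Or.inl hz)))
    (fun z hz => hs₂ z (hne z (Or.inl hz)))
  obtain HI := Hα P hPd hPL k hk1 hkK μ x₁ x₂ hx (fun y => (g y).im) F D hgI hD (fun z hz => hs₁ z (hne z (Or.inr hz)))
    (fun z hz => hs₂ z (hne z (Or.inr hz)))
  set ψ : Balaban1983to89.Site P 0 → ℂ := ((B1RG242Torus.tower P a 0).G k).map Complex.ofRealHom *ᵥ g with hψ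
  set δψ : Balaban1983to89.Site P 0 → ℂ := fun x => ((P.eps⁻¹ : ℝ) : ℂ) * (ψ (x.shift μ) - ψ x) with hδψ
  have hcov : ∀ x : Balaban1983to89.Site P 0, covD P.eps⁻¹ (cfg (gaugeAct h (1 : GaugeField P 0 U1)))
      (gBox (B1RG242Torus.α P a k * (P.L : ℝ) ^ (k * P.d)) P.eps⁻¹ (gaugeAct h (1 : GaugeField P 0 U1)) k univ *ᵥ f) ⟨x, μ⟩ =
        toC (h x) * δψ x := fun x => by
    rw [covD_gBox_pureGauge ha hk1 hk]; rfl
  have hx₂ : toC (h x₂) ≠ 0 := toC_ne_zero _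
  have hphase : toC (h x₁) * (toC (h x₂))⁻¹ * (toC (h x₂) * δψ x₂) - toC (h x₁) * δψ x₁ = toC (h x₁) * (δψ x₂ - δψ x₁) := by
    field_simp
  rw [hcov x₂, hcov x₁, hphase, norm_mul, norm_toC, one_mul]
  have hw : 0 ≤ ((P.L : ℝ) ^ k / B5Ineq137Torus.T P 0 x₁ x₂) ^ α :=
    Real.rpow_nonneg (div_nonneg (pow_nonneg (Nat.cast_nonneg _) _) (B5Ineq137Torus.T_nonneg P 0 x₁ x₂)) α
  have hre : ∀ x : Balaban1983to89.Site P 0, (δψ x).re =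
      ((B1RG242Torus.deriv P 0 P.eps μ * (B1RG242Torus.tower P a 0).G k) *ᵥ fun y => (g y).re) x := fun x => by
    rw [hδψ, ← mulVec_mulVec, B1RG242Torus.deriv_mulVec]
    simp only [Complex.re_ofReal_mul, Complex.sub_re, hψ, re_map_mulVec']
  have him : ∀ x : Balaban1983to89.Site P 0, (δψ x).im =
      ((B1RG242Torus.deriv P 0 P.eps μ * (B1RG242Torus.tower P a 0).G k) *ᵥ fun y => (g y).im) x := fun x => by
    rw [hδψ, ← mulVec_mulVec, B1RG242Torus.deriv_mulVec]
    simp only [Complex.im_ofReal_mul, Complex.sub_im, hψ, im_map_mulVec']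
  have E2 : 2 * c₀ * P.spacing k * Real.exp (-(δ₀ * (D / (P.L : ℝ) ^ k))) * F =
      c₀ * P.spacing k * Real.exp (-(δ₀ * (D / (P.L : ℝ) ^ k))) * F +
        c₀ * P.spacing k * Real.exp (-(δ₀ * (D / (P.L : ℝ) ^ k))) * F := by ring
  calc ((P.L : ℝ) ^ k / B5Ineq137Torus.T P 0 x₁ x₂) ^ α * ‖δψ x₂ - δψ x₁‖
      ≤ ((P.L : ℝ) ^ k / B5Ineq137Torus.T P 0 x₁ x₂) ^ α * (|(δψ x₂).re - (δψ x₁).re| + |(δψ x₂).im - (δψ x₁).im|) :=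
        mul_le_mul_of_nonneg_left (norm_sub_le_re_im' _ _) hw
    _ = ((P.L : ℝ) ^ k / B5Ineq137Torus.T P 0 x₁ x₂) ^ α * |(δψ x₂).re - (δψ x₁).re| +
          ((P.L : ℝ) ^ k / B5Ineq137Torus.T P 0 x₁ x₂) ^ α * |(δψ x₂).im - (δψ x₁).im| := mul_add _ _ _
    _ ≤ c₀ * P.spacing k * Real.exp (-(δ₀ * (D / (P.L : ℝ) ^ k))) * F +
          c₀ * P.spacing k * Real.exp (-(δ₀ * (D / (P.L : ℝ) ^ k))) * F := by
        rw [hre, hre, him, him]; exact add_le_add HR HI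
    _ = 2 * c₀ * P.spacing k * Real.exp (-(δ₀ * (D / (P.L : ℝ) ^ k))) * F := E2.symm

/-! ## §2 (v1.1, append-only) (2.36) for `Δ_k(T, 1^h)` = [I] (4.6.4)'s `Δ_k(u)` at flat `u`, on `T^{(k)}`, in level-`k` units -/

open BIJ88DeltaLoc234Torus (qMatT deltaRegion)
open BIJ88DeltaLocFlatClose235 (norm_qMq_apply_le blockLower_le_T norm_conj_qMatT_le conj_qMatT_ne_zero exp_blockLower_level_le
  deltaRegion_apply norm_coe_mul_one_apply scale_identity)

/-- **(2.36) FOR `Δ_k(T,1^h)` — THE WHOLE-TORUS REGION FORM ([I] (4.6.4)'s `Δ_k(u) = a_kI − a_k²Q_kG_k(u)Q_kᴴ`, `G_k(u) = G_k(T,u)`), AT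
EVERY PURE-GAUGE BACKGROUND, IN LEVEL-`k` UNITS, hypothesis-free** (print: *"|Δ_{k,loc}(u;x₁,x₂)| ≤ ce^{−c|x₁−x₂|}, (2.36)"*, p. 263, whose
comparison objects in (2.35) are the region forms `Δ_k(Ω,u)`): there are `δ₀, c₀ > 0` depending on `(d, L, a)` only such that for every torus
with these `d, L`, every `1 ≤ k ≤ K`, every `h` and ALL unit-lattice points `y₁, y₂ ∈ T^{(k)}`:
`‖Δ_k(T,1^h; y₁,y₂)‖ ≤ A·([y₁ = y₂] + a_k·c₀·e^{−δ₀|y₁−y₂|_{T^{(k)}}})`, `A = α_kL^{kd}` gen 15's counting normalization (`A/a_k = (L^kε)^{−2}L^{kd}`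
times the printed kernel, so the bracket is the printed `k`-uniform bound), `|y₁−y₂|_{T^{(k)}}` the unit-lattice sup-torus distance itself —
p31's `decay236_region_flat_level` with the box `Ω₀` replaced by `T`: §1's `decay110_flat_level` on the row sources `conj Q_k(y₂,·)`, p31's
block-sum bound `norm_qMq_apply_le`, block metric `exp_blockLower_level_le` and `scale_identity`. [cite: BalabanImbrieJaffe1988, (2.36) p.263]
[cite: BalabanImbrieJaffe1985, (4.6.4) p.312] -/
theorem decay236_torus_flat_level (d L : ℕ) (hd : 1 ≤ d) (hL : Odd L ∧ 1 < L) {a : ℝ} (ha : 0 < a) :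
    ∃ δ₀ c₀ : ℝ, 0 < δ₀ ∧ 0 < c₀ ∧ ∀ (P : Params), P.d = d → P.L = L →
      ∀ k : ℕ, 1 ≤ k → k ≤ P.K → ∀ (h : GaugeTransf P 0 U1) (y₁ y₂ : Balaban1983to89.Site P (0 + k)),
        ‖deltaRegion (B1RG242Torus.α P a k * (P.L : ℝ) ^ (k * P.d)) P.eps⁻¹ (gaugeAct h (1 : GaugeField P 0 U1)) k univ y₁ y₂‖ ≤
          (B1RG242Torus.α P a k * (P.L : ℝ) ^ (k * P.d)) *
            ((if y₁ = y₂ then 1 else 0) + B1.aSeq a P.L k * c₀ * Real.exp (-(δ₀ * (B5Ineq137Torus.T P (0 + k) y₁ y₂)))) := by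
  obtain ⟨δ₀, c₀, hδ₀, hc₀, H⟩ := decay110_flat_level d L hd hL ha
  refine ⟨δ₀, c₀ * Real.exp δ₀, hδ₀, by positivity, ?_⟩
  intro P hPd hPL k hk1 hkK h y₁ y₂
  have hk : 0 + k ≤ P.m + P.K := by omega
  set A := B1RG242Torus.α P a k * (P.L : ℝ) ^ (k * P.d) with hAdef
  have hak : 0 < B1.aSeq a P.L k := B1.aSeq_pos ha (B1RG242Torus.one_lt_cast_L P) hk1
  have hα : 0 < B1RG242Torus.α P a k := mul_pos hak (inv_pos.mpr (pow_pos (P.spacing_pos k) 2))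
  have hA0 : 0 ≤ A := (mul_pos hα (pow_pos P.cast_L_pos _)).le
  set G0 := gBox A P.eps⁻¹ (gaugeAct h (1 : GaugeField P 0 U1)) k univ with hG0def
  set Dl := max 0 (((P.L : ℝ) ^ k) * B5Ineq137Torus.T P (0 + k) y₁ y₂ - (((P.L : ℝ) ^ k) - 1)) with hDldef
  have hDl0 : 0 ≤ Dl := le_max_left _ _
  have hSandwich : ‖(qMatT (gaugeAct h (1 : GaugeField P 0 U1)) k * G0 * (qMatT (gaugeAct h (1 : GaugeField P 0 U1)) k)ᴴ) y₁ y₂‖ ≤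
      c₀ * P.spacing k ^ 2 * Real.exp (-(δ₀ * (Dl / (P.L : ℝ) ^ k))) * ((P.L : ℝ) ^ (k * P.d))⁻¹ :=
    norm_qMq_apply_le hk _ G0 y₁ y₂ fun x hx =>
      (H P hPd hPL k hk1 hkK h x _ _ Dl (fun x' => norm_conj_qMatT_le _ k y₂ x') hDl0
        (fun x' hx' => blockLower_le_T hk hx (conj_qMatT_ne_zero _ k hx'))).1
  have hexp : Real.exp (-(δ₀ * (Dl / (P.L : ℝ) ^ k))) ≤ Real.exp δ₀ * Real.exp (-(δ₀ * B5Ineq137Torus.T P (0 + k) y₁ y₂)) := by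
    rw [div_eq_inv_mul, hDldef]
    exact exp_blockLower_level_le y₁ y₂ hδ₀.le
  rw [deltaRegion_apply]
  calc ‖(A : ℂ) * (1 : Matrix _ _ ℂ) y₁ y₂ -
          ((A : ℂ) ^ 2) * (qMatT (gaugeAct h (1 : GaugeField P 0 U1)) k * G0 * (qMatT (gaugeAct h (1 : GaugeField P 0 U1)) k)ᴴ) y₁ y₂‖
      ≤ ‖(A : ℂ) * (1 : Matrix _ _ ℂ) y₁ y₂‖ +
          ‖((A : ℂ) ^ 2) * (qMatT (gaugeAct h (1 : GaugeField P 0 U1)) k * G0 * (qMatT (gaugeAct h (1 : GaugeField P 0 U1)) k)ᴴ) y₁ y₂‖ :=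
        norm_sub_le _ _
    _ ≤ A * (if y₁ = y₂ then 1 else 0) +
          A ^ 2 * (c₀ * P.spacing k ^ 2 * Real.exp (-(δ₀ * (Dl / (P.L : ℝ) ^ k))) * ((P.L : ℝ) ^ (k * P.d))⁻¹) := by
        rw [norm_coe_mul_one_apply hA0, norm_mul, norm_pow, Complex.norm_real, Real.norm_eq_abs, abs_of_nonneg hA0]
        exact add_le_add le_rfl (mul_le_mul_of_nonneg_left hSandwich (sq_nonneg _))
    _ = A * ((if y₁ = y₂ then 1 else 0) + B1.aSeq a P.L k * c₀ * Real.exp (-(δ₀ * (Dl / (P.L : ℝ) ^ k)))) := by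
        have e := scale_identity P a k
        rw [← hAdef] at e
        calc A * (if y₁ = y₂ then 1 else 0) +
              A ^ 2 * (c₀ * P.spacing k ^ 2 * Real.exp (-(δ₀ * (Dl / (P.L : ℝ) ^ k))) * ((P.L : ℝ) ^ (k * P.d))⁻¹)
            = A * (if y₁ = y₂ then 1 else 0) +
                A ^ 2 * (((P.L : ℝ) ^ (k * P.d))⁻¹ * P.spacing k ^ 2) * (c₀ * Real.exp (-(δ₀ * (Dl / (P.L : ℝ) ^ k)))) := by ring
          _ = A * ((if y₁ = y₂ then 1 else 0) + B1.aSeq a P.L k * c₀ * Real.exp (-(δ₀ * (Dl / (P.L : ℝ) ^ k)))) := by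
              rw [e]; ring
    _ ≤ A * ((if y₁ = y₂ then 1 else 0) +
          B1.aSeq a P.L k * (c₀ * Real.exp δ₀) * Real.exp (-(δ₀ * (B5Ineq137Torus.T P (0 + k) y₁ y₂)))) := by
        refine mul_le_mul_of_nonneg_left (add_le_add le_rfl ?_) hA0
        calc B1.aSeq a P.L k * c₀ * Real.exp (-(δ₀ * (Dl / (P.L : ℝ) ^ k)))
            ≤ B1.aSeq a P.L k * c₀ * (Real.exp δ₀ * Real.exp (-(δ₀ * B5Ineq137Torus.T P (0 + k) y₁ y₂))) :=
              mul_le_mul_of_nonneg_left hexp (by positivity)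
          _ = B1.aSeq a P.L k * (c₀ * Real.exp δ₀) * Real.exp (-(δ₀ * (B5Ineq137Torus.T P (0 + k) y₁ y₂))) := by ring

end

end Literature.MathematicalPhysics.QuantumFieldTheory.BalabanImbrieJaffe1984to88.BIJ88NeumannPropagatorFlatDecayLevel
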